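import Literature.AnabelianGeometry.EtaleTheta.Discharge.Sec5OfBiKummerDataKummer
import Literature.AnabelianGeometry.EtaleTheta.FrobenioidCyclotomicRigidity
import Literature.AlgebraicGeometry.Frobenioids.ModelFrobenioidAutAction
import HarnessLib

/-!
# [EtTh] Prop. 5.5 leaf P55-L06c (`hcup`) at the assembled §5 data ⟺ Galois-equivariance of the bi-Kummer cocycle of the root (pp. 317, 327–328, 331 / PDF pp. 91, 101–102, 105)

Mochizuki, *The étale theta function and its Frobenioid-theoretic manifestations*, Publ. RIMS **45** (2009)
[cite: MochizukiEtTh2009, Prop 5.5 proof p.327–328 (PDF pp.101–102); Prop 4.3 (iii) p.317 (PDF p.91); §5 p.331 (PDF p.105)].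
abc-iut cell, layer L2, sub-DAG `plan/L2/SUBDAG-EtTh-Thm56.md`, leaf **P55-L06c (`hcup`)** (seat abc-iut-L6-t23 g4, row (R5) of
abc-iut-L2-lead).  PROOF-ONLY over abc-iut-L2-t4's `FrobenioidThetaOfBiKummerData` / `Discharge/Sec5OfBiKummerDataKummer` (the §5 data
`ofBiKummerData …` assembled from abc-iut-L2-t3's §4 setting), `FrobenioidCyclotomicRigidity` (`ThetaSubquotientProj`) and abc-iut-L1's
`ModelFrobenioidAutAction` ([FrdI] Thm. 5.2 (i)).  No definition, no new named fact.

WHAT.  The structural binder `hcup` of abc-iut-w4-d008's `Thm56Sub.cyclotomicRigidity_of_laws` (`Discharge/Sec5Prop55OfLaws`), carried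
VERBATIM at the data by abc-iut-w5-d020's `cyclotomicRigidity_ofBiKummerData_of_laws`: for `g ∈ Aut_D(B_N^bs)` and `h ∈ H_{B_N}` over
`(l·Δ_Θ)_{B_N}` (`h ∈ P.pre`), `g h g⁻¹ ∈ H_{B_N}` and `s^⊔-gp_N(g h g⁻¹) = s^⊓-gp_N(g) · s^⊔-gp_N(h) · s^⊓-gp_N(g)⁻¹`.
(A, generic) The membership clause is free (`HB_normal`); the equation is conjugation-equivariance of the bi-Kummer difference
`d(h) = s^⊓-gp_N(h) · s^⊔-gp_N(h)⁻¹` of Prop. 4.3 (iii) (`sgpCup_conj_eq_iff`, group algebra).  (B, [FrdI] Thm. 5.2, namespace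
`ModelFrobenioid`) Conjugation by `Aut_C(X)` on `O^×(X)` is Galois pull-back of unit functions, `u_{e w e⁻¹} = Base(e⁻¹)^* u_w`
(`unit_conj_hom_of_mem_units`, from abc-iut-L1's `unit_conj'`); elements of `O^×(X)` are equal iff their unit functions are (`Φ` integral).
(C, at `ofBiKummerData`; inputs `hσ` — [FrdI] Prop. 5.6 section property of `s^trv_N` — and the [FrdI] Thm. 5.2 (ii) dictionary law `hfrac`
of `toB`, abc-iut-L2-t4's binders) With `x ∈ B(A_N^bs)` the rational function of the `N`-th root `f_N = s^⊓_N · (s^⊔_N)⁻¹` (`toB R.AN R.root`)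
and `γ ↦ γ^*` the pull-back action of `Aut_D(A_N^bs)` (the setting's `S.galoisSurj` at the Galois object `A_N^bs`): the unit function of
`d(ρ y)`, `y ∈ Π^tp_Ÿ̲`, read on `A_N^bs` along `(s^⊓_N)^bs`, is `x / (g⁻¹)^* x`, `g = ρ_{A_N}(ιX y)` (`pull_unit_biKummerDifference_mul`, from
abc-iut-L2-t4's Kummer-cocycle identity `pull_unit_sgpCap_mul_root`); whence **`sgpCup_conj_eq_iff_pull_root`** (pointwise) and
**`hcup_iff_pull_root_mul`**: `hcup(P)` ⟺ (KR) for all `y₀ ∈ Π^tp_X̲` and `y ∈ Π^tp_Ÿ̲` with `ρ(y)` over `(l·Δ_Θ)`,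
`g^*(g₀^* x) · x = g^* x · g₀^* x` — the Kummer cocycle `c(γ) = γ^* x / x` of the root is multiplicative at `(g₀, g)`, i.e. `g` FIXES
`c(g₀)`, i.e. (left action `γ ⋆ z = (γ⁻¹)^* z`, `κ(γ) = γ ⋆ x / x`) `κ(g₀ g g₀⁻¹) = g₀ ⋆ κ(g)`: the Galois-equivariance over `l·Δ_Θ` of the
étale-theta bi-Kummer cocycle, which print takes from "the detailed description of the 'étale theta class' in Proposition 1.3 …
manifestly 'functorial'" (Prop. 5.5 proof, p.327–328 (PDF pp.101–102)).  Both directions are proved, so the leaf moves one level down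
without loss; consumers replace `hcup` by `(hcup_iff_pull_root_mul … P).mpr hKR` (kernel-probed against `cyclotomicRigidity_ofBiKummerData_of_laws`).

WHY `hcup` IS NOT A THEOREM OUTRIGHT (honest): at `ofBiKummerData` the subquotient datum `P : ThetaSubquotientProj` and the stub
`(l·Δ_Θ)_{(−)} = Q` are FREE binders and `S.galoisSurj` is an abstract surjection, so `hcup` — which pins the agreement of the action of
`Π^tp_X̲` on `(l·Δ_Θ) ⊗ ℤ/N` by conjugation with its action on `μ_N(B_N)` through `s^⊓-gp_N` — is not derivable there as typed; (KR) is the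
one condition on `(S.galoisSurj, R)` it amounts to, dischargeable only where the Galois action on `B(A_N^bs)` and the theta subquotient are
genuine ([EtTh] Prop. 1.3, `η̈^Θ|_{l·Δ_Θ}`; GAP-LEDGER row G-L6t23-3).  HONEST FRAMING: kernel-checked equivalences between typed statements
about the assembled data; nothing of [EtTh] is asserted unconditionally; typed ≠ proved; no side is taken on [IUTchIII] Cor. 3.12.
-/



noncomputable section

namespace Literature.AlgebraicGeometry.Frobenioids

namespace ModelFrobenioid

open CategoryTheory Opposite

universe w v u

variable {D : Type u} [Category.{v} D] {Φ B : Dᵒᵖ ⥤ CommMonCat.{w}} {DivB : B ⟶ monoidGp Φ}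
  {X : ModelFrobenioid Φ B DivB}

/-- In the group `Aut_C(X)`: `(e · w · e⁻¹).hom = e⁻¹ ≫ w ≫ e` (diagrammatic). [folklore] -/
private theorem conj_hom_eq (e w : Aut X) : (e * w * e⁻¹).hom = e.inv ≫ w.hom ≫ e.hom := by
  rw [Aut.Aut_mul_def, Aut.Aut_mul_def, Aut.Aut_inv_def, Iso.trans_hom, Iso.trans_hom, Iso.symm_hom]

/-- `O^×(X)` is stable under conjugation by `Aut_C(X)` (`Base`, `deg_Fr` of the conjugate; [FrdI] Thm. 5.2 (i)).
[cite: MochizukiFrdI2008, Thm. 5.2 (i) p.100] -/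
theorem conj_mem_units (e : Aut X) {w : Aut X} (hw : w ∈ units X) : e * w * e⁻¹ ∈ units X := by
  refine ⟨?_, ?_⟩
  · rw [conj_hom_eq]; exact baseMap_conj' e hw.1
  · rw [conj_hom_eq]; exact degFr_conj' e hw.2

/-- **Conjugation by `Aut_C(X)` on `O^×(X)` is Galois pull-back of unit functions**: `u_{e w e⁻¹} = Base(e⁻¹)^* u_w`
([FrdI] Thm. 5.2 (i), the twist `u_e` cancels — `unit_conj'`).  [cite: MochizukiFrdI2008, Thm. 5.2 (i) p.100] -/
theorem unit_conj_hom_of_mem_units (e : Aut X) {w : Aut X} (hw : w ∈ units X) :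
    unit (e * w * e⁻¹).hom = pull B (baseMap e.inv) (unit w.hom) := by
  rw [conj_hom_eq]
  exact unit_conj' e hw.1 hw.2

/-- Elements of `O^×(X)` are equal iff their unit functions `u_(−) ∈ B(A_D)` are (`Φ(A_D)` integral: "the natural
inclusion `O^×(A) ↪ O^×(A^birat)`").  [cite: MochizukiFrdI2008, Thm. 5.2 (ii) p.101] -/
theorem eq_iff_unit_eq_of_mem_units (hΦ : IsIntegral (Φ.obj (op X.base))) {w w' : Aut X} (hw : w ∈ units X)
    (hw' : w' ∈ units X) : w = w' ↔ unit w.hom = unit w'.hom := by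
  refine ⟨fun e => e ▸ rfl, fun e => ?_⟩
  have key : unitsToRatFn X ⟨w, hw⟩ = unitsToRatFn X ⟨w', hw'⟩ := Units.ext e
  exact congrArg Subtype.val (unitsToRatFn_injective hΦ key)

/-- The unit function of a difference `a · c⁻¹` of two automorphisms: `u_{a c⁻¹} · Base(c⁻¹)^* u_c = Base(c⁻¹)^* u_a`
([FrdI] Thm. 5.2 (i) composition law, `deg_Fr = 1` on isomorphisms).  [cite: MochizukiFrdI2008, Thm. 5.2 (i) p.100] -/
theorem unit_mul_inv_hom_mul (a c : Aut X) :
    unit (a * c⁻¹).hom * pull B (baseMap c.inv) (unit c.hom) = pull B (baseMap c.inv) (unit a.hom) := by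
  rw [Aut.Aut_mul_def, Aut.Aut_inv_def, Iso.trans_hom, Iso.symm_hom,
    unit_comp_of_degFr_eq_one _ (degFr_hom_eq_one a).1, mul_assoc, mul_comm (unit c.inv),
    pull_unit_hom_mul_unit_inv, mul_one]

/-- In the group `Aut X`: `(e · w · e⁻¹)⁻¹ = e⁻¹ ≫ w⁻¹ ≫ e` on inverse arrows (diagrammatic). [folklore] -/
private theorem conj_inv_eq {C : Type*} [Category C] {Y : C} (e w : Aut Y) : (e * w * e⁻¹).inv = e.inv ≫ w.inv ≫ e.hom := by
  rw [Aut.Aut_mul_def, Aut.Aut_mul_def, Aut.Aut_inv_def, Iso.trans_inv, Iso.trans_inv, Iso.symm_inv, Category.assoc]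

/-- `γ^* ∘ (γ⁻¹)^* = id` for an isomorphism `γ` of `D` ([FrdI] Def. 1.1 (ii) bookkeeping). [cite: MochizukiFrdI2008, Def. 1.1(ii)] -/
theorem pull_hom_pull_inv {A A' : D} (γ : A ≅ A') (z : B.obj (op A)) : pull B γ.hom (pull B γ.inv z) = z := by
  rw [← pull_comp, Iso.hom_inv_id, pull_id]

/-- Cancellation bookkeeping in a cancellative commutative monoid: if `p₁ a = x₁` and `p₂ b = x₂` then
`p₁ = p₂ ↔ x₁ b = x₂ a`. [folklore] -/
private theorem eq_iff_of_mul_eq {M : Type*} [CommMonoid M] [IsCancelMul M] {p₁ p₂ a b x₁ x₂ : M} (h₁ : p₁ * a = x₁)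
    (h₂ : p₂ * b = x₂) : p₁ = p₂ ↔ x₁ * b = x₂ * a := by
  constructor
  · rintro rfl
    rw [← h₁, ← h₂, mul_right_comm]
  · intro e
    apply mul_right_cancel (b := a * b)
    calc p₁ * (a * b) = x₁ * b := by rw [← mul_assoc, h₁]
      _ = x₂ * a := e
      _ = p₂ * (a * b) := by rw [← h₂, mul_assoc, mul_comm b a]

end ModelFrobenioid

end Literature.AlgebraicGeometry.Frobenioids

namespace Literature.AnabelianGeometry.EtaleTheta

open CategoryTheory Opposite Literature.AlgebraicGeometry.Frobenioids
open Literature.AlgebraicGeometry.Frobenioids.PreFrobenioid (pull_injective)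

universe u₀ v₀ u v w w' v' u' u''

namespace ThetaFrobenioid

/-! ### Generic: `hcup` is conjugation-equivariance of the bi-Kummer difference -/

section Generic

variable {C : Type u'} [Category.{v'} C] {D : Type u''} [Category.{w'} D] (𝔉 : ThetaFrobenioid.{w} C D)

/-- `H_{B_N} = ρ(Π^tp_Ÿ̲)` is a NORMAL subgroup of `Aut_D(B_N^bs)` (`Π^tp_Ÿ̲ ⊴ Π^tp_X̲` — "`A_⊚^bs` is 'characteristic' … hence
Galois", p.322 (PDF p.96) — and `ρ` is surjective, Def. 4.1 (ii)).  [cite: MochizukiEtTh2009, §5 p.322 (PDF p.96); Def 4.1 (ii) p.313 (PDF p.87)] -/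
theorem HB_normal : 𝔉.HB.Normal := by
  haveI := 𝔉.PiYdd_normal
  exact Subgroup.Normal.map inferInstance 𝔉.ρ 𝔉.ρ_surjective

/-- The conjugate `g h g⁻¹` of `h ∈ H_{B_N}` by `g ∈ Aut_D(B_N^bs)` lies in `H_{B_N}`.  [cite: MochizukiEtTh2009, §5 p.331 (PDF p.105)] -/
theorem conj_mem_HB (g : Aut (𝔉.base.obj 𝔉.BN)) (h : 𝔉.HB) : g * (h : Aut (𝔉.base.obj 𝔉.BN)) * g⁻¹ ∈ 𝔉.HB :=
  𝔉.HB_normal.conj_mem _ h.2 g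

/-- **`hcup` is conjugation-equivariance of the bi-Kummer difference** (pure group algebra, `s^⊓-gp_N` a homomorphism):
`s^⊔-gp_N(g h g⁻¹) = s^⊓-gp_N(g) s^⊔-gp_N(h) s^⊓-gp_N(g)⁻¹` iff the difference `d(h) = s^⊓-gp_N(h) · s^⊔-gp_N(h)⁻¹` of
Prop. 4.3 (iii) (print's orientation, p.317 (PDF p.91)) satisfies `d(g h g⁻¹) = s^⊓-gp_N(g) · d(h) · s^⊓-gp_N(g)⁻¹`.
[cite: MochizukiEtTh2009, Prop 4.3 (iii) p.317 (PDF p.91); §5 p.331 (PDF p.105)] -/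
theorem sgpCup_conj_eq_iff (g : Aut (𝔉.base.obj 𝔉.BN)) (h : 𝔉.HB)
    (hmem : g * (h : Aut (𝔉.base.obj 𝔉.BN)) * g⁻¹ ∈ 𝔉.HB) :
    𝔉.sgpCup ⟨g * (h : Aut (𝔉.base.obj 𝔉.BN)) * g⁻¹, hmem⟩ = 𝔉.sgpCap g * 𝔉.sgpCup h * (𝔉.sgpCap g)⁻¹ ↔
      𝔉.sgpCap (g * (h : Aut (𝔉.base.obj 𝔉.BN)) * g⁻¹) *
          (𝔉.sgpCup ⟨g * (h : Aut (𝔉.base.obj 𝔉.BN)) * g⁻¹, hmem⟩)⁻¹ =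
        𝔉.sgpCap g * (𝔉.sgpCap (h : Aut (𝔉.base.obj 𝔉.BN)) * (𝔉.sgpCup h)⁻¹) * (𝔉.sgpCap g)⁻¹ := by
  have key : 𝔉.sgpCap g * (𝔉.sgpCap (h : Aut (𝔉.base.obj 𝔉.BN)) * (𝔉.sgpCup h)⁻¹) * (𝔉.sgpCap g)⁻¹ =
      𝔉.sgpCap g * 𝔉.sgpCap (h : Aut (𝔉.base.obj 𝔉.BN)) * (𝔉.sgpCap g)⁻¹ *
        (𝔉.sgpCap g * 𝔉.sgpCup h * (𝔉.sgpCap g)⁻¹)⁻¹ := by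
    group
  rw [map_mul, map_mul, map_inv, key, mul_right_inj, inv_inj]

/-- The same with the conjugate presented as any `k ∈ H_{B_N}` with `k = g h g⁻¹` (bookkeeping form).
[cite: MochizukiEtTh2009, Prop 4.3 (iii) p.317 (PDF p.91); §5 p.331 (PDF p.105)] -/
theorem sgpCup_eq_conj_iff (g : Aut (𝔉.base.obj 𝔉.BN)) (h k : 𝔉.HB)
    (hk : (k : Aut (𝔉.base.obj 𝔉.BN)) = g * (h : Aut (𝔉.base.obj 𝔉.BN)) * g⁻¹) :
    𝔉.sgpCup k = 𝔉.sgpCap g * 𝔉.sgpCup h * (𝔉.sgpCap g)⁻¹ ↔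
      𝔉.sgpCap (k : Aut (𝔉.base.obj 𝔉.BN)) * (𝔉.sgpCup k)⁻¹ =
        𝔉.sgpCap g * (𝔉.sgpCap (h : Aut (𝔉.base.obj 𝔉.BN)) * (𝔉.sgpCup h)⁻¹) * (𝔉.sgpCap g)⁻¹ := by
  obtain ⟨k, hkmem⟩ := k
  change k = _ at hk
  subst hk
  exact 𝔉.sgpCup_conj_eq_iff g h hkmem

end Generic

/-! ### At the assembled §5 data `ofBiKummerData`: the bi-Kummer difference read in `B(A_N^bs)` -/

section Kummer

variable {K : Type u₀} [Field K] {X : SemiGraphs.TemperedArithmeticGroup.{u₀} K} {D₀ : Type u₀} [Category.{v₀} D₀]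
  {V : FrdIMonoidStub.{w}} {T₀ : RealifiedDivisorMonoids (D₀ := D₀) V} {D : Type u} [Category.{v} D]
  {VD : FrdICatStub.{u, v, w} D} {S : BiKummerSetting X T₀ D VD}
  {pullFrac : ∀ {A A' : S.C} (_ : A' ⟶ A), S.biratUnits A → S.biratUnits A'}
  {lv N : ℕ+} {T : ThetaEnvData.{max v w} N} {θ : S.biratUnits S.Aodot} {Bl : S.C}
  {Pl : S.FractionPair θ Bl} {Rl : S.NthRoot θ Pl lv pullFrac}
  (h : ModelFrobenioid.Hypotheses S.tf.divisorMonoid S.tf.ratFnFunctor)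
  (toB : ∀ A : S.C, S.biratUnits A →* S.tf.biratUnitsModel A) (Q : FrobenioidTheta.ThetaSubquotientStub.{w} D)
  (odd_l : Odd (lv : ℕ)) (R : S.NthRoot Rl.root Rl.pair N pullFrac) (ιX : T.PiX ≃ₜ* X.Pi)
  (hopen : IsOpen ((S.galoisSurj R.AN.base R.αData.isGalois).ker : Set X.Pi)) (σ : Aut R.AN.base →* Aut R.AN)
  (K' : Type w) [Field K'] (constEmb : K'ˣ →* S.tf.biratUnitsModel R.BN)
  (constEmb_injective : Function.Injective constEmb)
  (hdivc : ∀ g : Aut R.BN.base,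
    ModelFrobenioid.div ((σ ((BiKummerSetting.NthRoot.baseIso S R).conjAut.symm g)).hom ≫ R.pair.num) =
      ModelFrobenioid.div R.pair.num)
  (hdivp : ∀ y : T.PiYdd,
    ModelFrobenioid.div ((σ (S.galoisSurj R.AN.base R.αData.isGalois (ιX y.1))).hom ≫ R.pair.den) =
      ModelFrobenioid.div R.pair.den)

/-- `Base(s^⊓-gp_N(g)⁻¹) = g⁻¹` (section property `SgpCapSection` of the assembled data, from `hσ`).
[cite: MochizukiEtTh2009, §5 p.331 (PDF p.105)] -/
theorem baseMap_sgpCap_inv (hσ : ∀ g : Aut R.AN.base, ModelFrobenioid.baseMap (σ g).hom = g.hom)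
    (g : Aut R.BN.base) : ModelFrobenioid.baseMap ((ofBiKummerData h toB Q odd_l R ιX hopen σ K' constEmb constEmb_injective hdivc hdivp).sgpCap g).inv = g.inv :=
  congrArg Iso.inv (sgpCapSection_ofBiKummerData h toB Q odd_l R ιX hopen σ K' constEmb constEmb_injective hdivc hdivp hσ g)

/-- `Base(s^⊔-gp_N(h)⁻¹) = h⁻¹` on `H_{B_N}` (`SgpCupSection` of the assembled data, from `hσ`).
[cite: MochizukiEtTh2009, §5 p.331 (PDF p.105)] -/
theorem baseMap_sgpCup_inv (hσ : ∀ g : Aut R.AN.base, ModelFrobenioid.baseMap (σ g).hom = g.hom)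
    (y : T.PiX) (hy : y ∈ T.PiYdd) :
    ModelFrobenioid.baseMap ((ofBiKummerData h toB Q odd_l R ιX hopen σ K' constEmb constEmb_injective hdivc hdivp).sgpCup ⟨rhoOfBiKummerData R ιX y, Subgroup.mem_map_of_mem _ hy⟩).inv =
      (rhoOfBiKummerData R ιX y).inv :=
  congrArg Iso.inv (sgpCupSection_ofBiKummerData h toB Q odd_l R ιX hopen σ K' constEmb constEmb_injective hdivc hdivp hσ ⟨rhoOfBiKummerData R ιX y, Subgroup.mem_map_of_mem _ hy⟩)

/-- The bi-Kummer difference `d(h) = s^⊓-gp_N(h) · s^⊔-gp_N(h)⁻¹` lies in `O^×(B_N)` (Prop. 4.3 (iii); both sections lie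
over `h`).  [cite: MochizukiEtTh2009, Prop 4.3 (iii) p.317 (PDF p.91)] -/
theorem sgpCap_mul_sgpCup_inv_mem_units (hσ : ∀ g : Aut R.AN.base, ModelFrobenioid.baseMap (σ g).hom = g.hom)
    (y : T.PiX) (hy : y ∈ T.PiYdd) :
    (ofBiKummerData h toB Q odd_l R ιX hopen σ K' constEmb constEmb_injective hdivc hdivp).sgpCap (rhoOfBiKummerData R ιX y) *
        ((ofBiKummerData h toB Q odd_l R ιX hopen σ K' constEmb constEmb_injective hdivc hdivp).sgpCup ⟨rhoOfBiKummerData R ιX y, Subgroup.mem_map_of_mem _ hy⟩)⁻¹ ∈ (ofBiKummerData h toB Q odd_l R ιX hopen σ K' constEmb constEmb_injective hdivc hdivp).units (ofBiKummerData h toB Q odd_l R ιX hopen σ K' constEmb constEmb_injective hdivc hdivp).BN := by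
  have h1 := sgpCup_mul_sgpCap_inv_mem_units _ (sgpCapSection_ofBiKummerData h toB Q odd_l R ιX hopen σ K' constEmb constEmb_injective hdivc hdivp hσ)
    (sgpCupSection_ofBiKummerData h toB Q odd_l R ιX hopen σ K' constEmb constEmb_injective hdivc hdivp hσ) ⟨rhoOfBiKummerData R ιX y, Subgroup.mem_map_of_mem _ hy⟩
  have h2 := Subgroup.inv_mem _ h1
  rwa [mul_inv_rev, inv_inv] at h2

/-- Pull-back along `(s^⊓_N)^bs` intertwines `ρ(y)⁻¹` on `B_N^bs` with `ρ_{A_N}(ιX y)⁻¹` on `A_N^bs` (`ρ` is the transport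
of the setting's Galois action along `(s^⊓_N)^bs`, p.331 (PDF p.105)).  [cite: MochizukiEtTh2009, §5 p.331 (PDF p.105)] -/
theorem pull_num_pull_rho_inv (y : T.PiX) (z : S.tf.ratFnFunctor.obj (op (ofBiKummerData h toB Q odd_l R ιX hopen σ K' constEmb constEmb_injective hdivc hdivp).BN.base)) :
    pull S.tf.ratFnFunctor (ModelFrobenioid.baseMap R.pair.num)
        (pull S.tf.ratFnFunctor (A := (ofBiKummerData h toB Q odd_l R ιX hopen σ K' constEmb constEmb_injective hdivc hdivp).BN.base) (B := (ofBiKummerData h toB Q odd_l R ιX hopen σ K' constEmb constEmb_injective hdivc hdivp).BN.base) (rhoOfBiKummerData R ιX y).inv z) =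
      pull S.tf.ratFnFunctor (S.galoisSurj R.AN.base R.αData.isGalois (ιX y)).inv
        (pull S.tf.ratFnFunctor (ModelFrobenioid.baseMap R.pair.num) z) := by
  have hb : ModelFrobenioid.baseMap R.pair.num ≫ (rhoOfBiKummerData R ιX y).inv =
      (S.galoisSurj R.AN.base R.αData.isGalois (ιX y)).inv ≫ ModelFrobenioid.baseMap R.pair.num := by
    rw [rhoOfBiKummerData_apply, Iso.conjAut_apply, Iso.trans_inv, Iso.trans_inv, Iso.symm_inv,
      ← BiKummerSetting.NthRoot.baseIso_hom]
    simp only [Category.assoc, Iso.hom_inv_id_assoc]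
  calc pull S.tf.ratFnFunctor (ModelFrobenioid.baseMap R.pair.num)
        (pull S.tf.ratFnFunctor (A := (ofBiKummerData h toB Q odd_l R ιX hopen σ K' constEmb constEmb_injective hdivc hdivp).BN.base) (B := (ofBiKummerData h toB Q odd_l R ιX hopen σ K' constEmb constEmb_injective hdivc hdivp).BN.base) (rhoOfBiKummerData R ιX y).inv z)
      = pull S.tf.ratFnFunctor (ModelFrobenioid.baseMap R.pair.num ≫ (rhoOfBiKummerData R ιX y).inv) z :=
        (pull_comp S.tf.ratFnFunctor (ModelFrobenioid.baseMap R.pair.num) (rhoOfBiKummerData R ιX y).inv z).symm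
    _ = pull S.tf.ratFnFunctor ((S.galoisSurj R.AN.base R.αData.isGalois (ιX y)).inv ≫
          ModelFrobenioid.baseMap R.pair.num) z := by rw [hb]
    _ = _ := pull_comp S.tf.ratFnFunctor _ _ z

/-- **The bi-Kummer difference IS the Kummer cocycle of the root** (Prop. 4.3 (iii) "follows immediately from the
definitions", p.317 (PDF p.91), for the lifts of p.331 (PDF p.105)): with `x ∈ B(A_N^bs)` the rational function of the
`N`-th root `f_N = s^⊓_N · (s^⊔_N)⁻¹` and `g = ρ_{A_N}(ιX y)`, `y ∈ Π^tp_Ÿ̲`, the unit function of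
`d(ρ(y)) = s^⊓-gp_N(ρ y) · s^⊔-gp_N(ρ y)⁻¹ ∈ O^×(B_N)`, read on `A_N^bs` along `(s^⊓_N)^bs`, satisfies
`((s^⊓_N)^bs)^* u_{d(ρ y)} · (g⁻¹)^* x = x` — i.e. it is `x / (g⁻¹)^* x` (abc-iut-L2-t4's Kummer-cocycle identity
`pull_unit_sgpCap_mul_root` combined with the [FrdI] Thm. 5.2 (i) unit laws).
[cite: MochizukiEtTh2009, Prop 4.3 (iii) p.317 (PDF p.91); §5 p.331 (PDF p.105)] -/
theorem pull_unit_biKummerDifference_mul (hσ : ∀ g : Aut R.AN.base, ModelFrobenioid.baseMap (σ g).hom = g.hom)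
    (hfrac : ∀ {A B : S.C} (s' s'' : A ⟶ B) (h' : S.IsPreStep s') (h'' : S.IsPreStep s'')
      (hb : PreFrobenioid.BaseEquivalent S.F s' s''),
      (toB A (S.fracOf s' s'' h' h'' hb) : S.tf.ratFnFunctor.obj (op A.base)) *
        ModelFrobenioid.unit s'' = ModelFrobenioid.unit s')
    (y : T.PiX) (hy : y ∈ T.PiYdd) :
    pull S.tf.ratFnFunctor (ModelFrobenioid.baseMap R.pair.num)
        (ModelFrobenioid.unit ((ofBiKummerData h toB Q odd_l R ιX hopen σ K' constEmb constEmb_injective hdivc hdivp).sgpCap (rhoOfBiKummerData R ιX y) *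
          ((ofBiKummerData h toB Q odd_l R ιX hopen σ K' constEmb constEmb_injective hdivc hdivp).sgpCup ⟨rhoOfBiKummerData R ιX y, Subgroup.mem_map_of_mem _ hy⟩)⁻¹).hom) *
      pull S.tf.ratFnFunctor (S.galoisSurj R.AN.base R.αData.isGalois (ιX y)).inv
        (toB R.AN R.root : S.tf.ratFnFunctor.obj (op R.AN.base)) =
      (toB R.AN R.root : S.tf.ratFnFunctor.obj (op R.AN.base)) := by
  haveI : IsCancelMul (S.tf.ratFnFunctor.obj (op R.AN.base)) :=
    isIntegral_iff_isCancelMul.mp (h.isGroupLike_rat R.AN.base).isPreDivisorial.isIntegral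
  -- the [FrdI] unit law for the difference, pulled back to `A_N^bs`
  have U1 := ModelFrobenioid.unit_mul_inv_hom_mul ((ofBiKummerData h toB Q odd_l R ιX hopen σ K' constEmb constEmb_injective hdivc hdivp).sgpCap (rhoOfBiKummerData R ιX y))
    ((ofBiKummerData h toB Q odd_l R ιX hopen σ K' constEmb constEmb_injective hdivc hdivp).sgpCup ⟨rhoOfBiKummerData R ιX y, Subgroup.mem_map_of_mem _ hy⟩)
  rw [baseMap_sgpCup_inv h toB Q odd_l R ιX hopen σ K' constEmb constEmb_injective hdivc hdivp hσ y hy] at U1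
  have U2 : pull S.tf.ratFnFunctor (ModelFrobenioid.baseMap R.pair.num)
        (ModelFrobenioid.unit ((ofBiKummerData h toB Q odd_l R ιX hopen σ K' constEmb constEmb_injective hdivc hdivp).sgpCap (rhoOfBiKummerData R ιX y) *
          ((ofBiKummerData h toB Q odd_l R ιX hopen σ K' constEmb constEmb_injective hdivc hdivp).sgpCup ⟨rhoOfBiKummerData R ιX y, Subgroup.mem_map_of_mem _ hy⟩)⁻¹).hom) *
      pull S.tf.ratFnFunctor (S.galoisSurj R.AN.base R.αData.isGalois (ιX y)).inv
        (pull S.tf.ratFnFunctor (ModelFrobenioid.baseMap R.pair.num)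
          (ModelFrobenioid.unit ((ofBiKummerData h toB Q odd_l R ιX hopen σ K' constEmb constEmb_injective hdivc hdivp).sgpCup ⟨rhoOfBiKummerData R ιX y, Subgroup.mem_map_of_mem _ hy⟩).hom)) =
      pull S.tf.ratFnFunctor (S.galoisSurj R.AN.base R.αData.isGalois (ιX y)).inv
        (pull S.tf.ratFnFunctor (ModelFrobenioid.baseMap R.pair.num)
          (ModelFrobenioid.unit ((ofBiKummerData h toB Q odd_l R ιX hopen σ K' constEmb constEmb_injective hdivc hdivp).sgpCap (rhoOfBiKummerData R ιX y)).hom)) := by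
    rw [← pull_num_pull_rho_inv h toB Q odd_l R ιX hopen σ K' constEmb constEmb_injective hdivc hdivp, ← pull_num_pull_rho_inv h toB Q odd_l R ιX hopen σ K' constEmb constEmb_injective hdivc hdivp, ← map_mul]
    exact congrArg _ U1
  -- abc-iut-L2-t4's Kummer-cocycle identity, pulled back along `g⁻¹`
  have E := pull_unit_sgpCap_mul_root h toB Q odd_l R ιX hopen σ K' constEmb constEmb_injective hdivc hdivp hfrac y hy
  rw [hσ] at E
  have E' := congrArg (pull S.tf.ratFnFunctor (S.galoisSurj R.AN.base R.αData.isGalois (ιX y)).inv) E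
  rw [map_mul, map_mul, ← pull_comp S.tf.ratFnFunctor (S.galoisSurj R.AN.base R.αData.isGalois (ιX y)).inv
    (S.galoisSurj R.AN.base R.αData.isGalois (ιX y)).hom, Iso.inv_hom_id, pull_id] at E'
  apply mul_right_cancel (b := pull S.tf.ratFnFunctor (S.galoisSurj R.AN.base R.αData.isGalois (ιX y)).inv
    (pull S.tf.ratFnFunctor (ModelFrobenioid.baseMap R.pair.num)
      (ModelFrobenioid.unit ((ofBiKummerData h toB Q odd_l R ιX hopen σ K' constEmb constEmb_injective hdivc hdivp).sgpCup ⟨rhoOfBiKummerData R ιX y, Subgroup.mem_map_of_mem _ hy⟩).hom)))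
  rw [mul_right_comm, U2]
  exact E'

/-- **P55-L06c (`hcup`) pointwise ⟺ multiplicativity of the Kummer cocycle of the root.**  For `y₀ ∈ Π^tp_X̲`, `y ∈ Π^tp_Ÿ̲`,
`g₀ = ρ_{A_N}(ιX y₀)`, `g = ρ_{A_N}(ιX y)` and `x ∈ B(A_N^bs)` the rational function of the `N`-th root:
`s^⊔-gp_N(ρ(y₀) ρ(y) ρ(y₀)⁻¹) = s^⊓-gp_N(ρ y₀) · s^⊔-gp_N(ρ y) · s^⊓-gp_N(ρ y₀)⁻¹` iff `g^*(g₀^* x) · x = g^* x · g₀^* x`, i.e. iff the Kummer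
cocycle `c(γ) = γ^* x · x⁻¹` satisfies `c(g₀ g) = c(g₀) · c(g)`, i.e. iff `g` FIXES `c(g₀)` — the Galois-equivariance `κ(g₀ g g₀⁻¹) = g₀ ⋆ κ(g)`
of the étale-theta bi-Kummer cocycle at `(g₀, g)` (Prop. 5.5 proof, p.327 (PDF p.101): "it follows from the detailed description of the étale
theta class in Proposition 1.3 that the resulting Kummer class … determines an isomorphism … manifestly functorial").  Inputs: `hσ` ([FrdI]
Prop. 5.6) and the dictionary law `hfrac` of `toB`.  [cite: MochizukiEtTh2009, Prop 5.5 proof p.327–328 (PDF pp.101–102); Prop 4.3 (iii) p.317 (PDF p.91)] -/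
theorem sgpCup_conj_eq_iff_pull_root (hσ : ∀ g : Aut R.AN.base, ModelFrobenioid.baseMap (σ g).hom = g.hom)
    (hfrac : ∀ {A B : S.C} (s' s'' : A ⟶ B) (h' : S.IsPreStep s') (h'' : S.IsPreStep s'')
      (hb : PreFrobenioid.BaseEquivalent S.F s' s''),
      (toB A (S.fracOf s' s'' h' h'' hb) : S.tf.ratFnFunctor.obj (op A.base)) *
        ModelFrobenioid.unit s'' = ModelFrobenioid.unit s')
    (y₀ y : T.PiX) (hy : y ∈ T.PiYdd) (k : (ofBiKummerData h toB Q odd_l R ιX hopen σ K' constEmb constEmb_injective hdivc hdivp).HB)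
    (hk : (k : Aut ((ofBiKummerData h toB Q odd_l R ιX hopen σ K' constEmb constEmb_injective hdivc hdivp).base.obj (ofBiKummerData h toB Q odd_l R ιX hopen σ K' constEmb constEmb_injective hdivc hdivp).BN)) =
      rhoOfBiKummerData R ιX y₀ * rhoOfBiKummerData R ιX y * (rhoOfBiKummerData R ιX y₀)⁻¹) :
    (ofBiKummerData h toB Q odd_l R ιX hopen σ K' constEmb constEmb_injective hdivc hdivp).sgpCup k =
        (ofBiKummerData h toB Q odd_l R ιX hopen σ K' constEmb constEmb_injective hdivc hdivp).sgpCap (rhoOfBiKummerData R ιX y₀) * (ofBiKummerData h toB Q odd_l R ιX hopen σ K' constEmb constEmb_injective hdivc hdivp).sgpCup ⟨rhoOfBiKummerData R ιX y, Subgroup.mem_map_of_mem _ hy⟩ *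
          ((ofBiKummerData h toB Q odd_l R ιX hopen σ K' constEmb constEmb_injective hdivc hdivp).sgpCap (rhoOfBiKummerData R ιX y₀))⁻¹ ↔
      pull S.tf.ratFnFunctor (S.galoisSurj R.AN.base R.αData.isGalois (ιX y)).hom
          (pull S.tf.ratFnFunctor (S.galoisSurj R.AN.base R.αData.isGalois (ιX y₀)).hom
            (toB R.AN R.root : S.tf.ratFnFunctor.obj (op R.AN.base))) *
          (toB R.AN R.root : S.tf.ratFnFunctor.obj (op R.AN.base)) =
        pull S.tf.ratFnFunctor (S.galoisSurj R.AN.base R.αData.isGalois (ιX y)).hom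
            (toB R.AN R.root : S.tf.ratFnFunctor.obj (op R.AN.base)) *
          pull S.tf.ratFnFunctor (S.galoisSurj R.AN.base R.αData.isGalois (ιX y₀)).hom
            (toB R.AN R.root : S.tf.ratFnFunctor.obj (op R.AN.base)) := by
  haveI : IsCancelMul (S.tf.ratFnFunctor.obj (op R.AN.base)) :=
    isIntegral_iff_isCancelMul.mp (h.isGroupLike_rat R.AN.base).isPreDivisorial.isIntegral
  haveI : IsIso (ModelFrobenioid.baseMap R.pair.num) := R.pair.isPreStep_num.2
  have hy' : y₀ * y * y₀⁻¹ ∈ T.PiYdd := (ofBiKummerData h toB Q odd_l R ιX hopen σ K' constEmb constEmb_injective hdivc hdivp).PiYdd_normal.conj_mem y hy y₀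
  have e1 : rhoOfBiKummerData R ιX y₀ * rhoOfBiKummerData R ιX y * (rhoOfBiKummerData R ιX y₀)⁻¹ =
      rhoOfBiKummerData R ιX (y₀ * y * y₀⁻¹) := by rw [map_mul, map_mul, map_inv]
  -- (1) group algebra: the equation is conjugation-equivariance of the difference `d = s^⊓-gp · (s^⊔-gp)⁻¹`
  refine ((ofBiKummerData h toB Q odd_l R ιX hopen σ K' constEmb constEmb_injective hdivc hdivp).sgpCup_eq_conj_iff (rhoOfBiKummerData R ιX y₀)
    ⟨rhoOfBiKummerData R ιX y, Subgroup.mem_map_of_mem _ hy⟩ k hk).trans ?_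
  have hk' : k = ⟨rhoOfBiKummerData R ιX (y₀ * y * y₀⁻¹), Subgroup.mem_map_of_mem _ hy'⟩ := Subtype.ext (hk.trans e1)
  subst hk'
  -- (2) both sides lie in `O^×(B_N)`; compare unit functions, the conjugate's being the Galois pull-back
  refine (ModelFrobenioid.eq_iff_unit_eq_of_mem_units (X := (ofBiKummerData h toB Q odd_l R ιX hopen σ K' constEmb constEmb_injective hdivc hdivp).BN) (h.isDivisorial R.BN.base).isPreDivisorial.isIntegral
    (sgpCap_mul_sgpCup_inv_mem_units h toB Q odd_l R ιX hopen σ K' constEmb constEmb_injective hdivc hdivp hσ _ hy')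
    (ModelFrobenioid.conj_mem_units (X := (ofBiKummerData h toB Q odd_l R ιX hopen σ K' constEmb constEmb_injective hdivc hdivp).BN) _ (sgpCap_mul_sgpCup_inv_mem_units h toB Q odd_l R ιX hopen σ K' constEmb constEmb_injective hdivc hdivp hσ y hy))).trans ?_
  rw [ModelFrobenioid.unit_conj_hom_of_mem_units (X := (ofBiKummerData h toB Q odd_l R ιX hopen σ K' constEmb constEmb_injective hdivc hdivp).BN) _ (sgpCap_mul_sgpCup_inv_mem_units h toB Q odd_l R ιX hopen σ K' constEmb constEmb_injective hdivc hdivp hσ y hy),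
    baseMap_sgpCap_inv h toB Q odd_l R ιX hopen σ K' constEmb constEmb_injective hdivc hdivp hσ]
  -- (3) read on `A_N^bs` along `(s^⊓_N)^bs`
  refine (pull_injective (Φ := S.tf.ratFnFunctor) (ModelFrobenioid.baseMap R.pair.num)).eq_iff.symm.trans ?_
  rw [pull_num_pull_rho_inv h toB Q odd_l R ιX hopen σ K' constEmb constEmb_injective hdivc hdivp]
  -- (4) both differences are Kummer cocycle values of the root
  have K2 := congrArg (pull S.tf.ratFnFunctor (S.galoisSurj R.AN.base R.αData.isGalois (ιX y₀)).inv)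
    (pull_unit_biKummerDifference_mul h toB Q odd_l R ιX hopen σ K' constEmb constEmb_injective hdivc hdivp hσ hfrac y hy)
  rw [map_mul] at K2
  refine (ModelFrobenioid.eq_iff_of_mul_eq (pull_unit_biKummerDifference_mul h toB Q odd_l R ιX hopen σ K' constEmb constEmb_injective hdivc hdivp hσ hfrac _ hy') K2).trans ?_
  -- (5) cocycle algebra: clear the inverses by pulling back along `g₀`, then `g`
  have e3 : S.galoisSurj R.AN.base R.αData.isGalois (ιX (y₀ * y * y₀⁻¹)) =
      S.galoisSurj R.AN.base R.αData.isGalois (ιX y₀) * S.galoisSurj R.AN.base R.αData.isGalois (ιX y) *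
        (S.galoisSurj R.AN.base R.αData.isGalois (ιX y₀))⁻¹ := by
    simp only [map_mul, map_inv]
  rw [e3, ModelFrobenioid.conj_inv_eq, pull_comp, pull_comp]
  refine (pull_injective (Φ := S.tf.ratFnFunctor) (S.galoisSurj R.AN.base R.αData.isGalois (ιX y₀)).hom).eq_iff.symm.trans
    ?_
  simp only [map_mul, ModelFrobenioid.pull_hom_pull_inv]
  refine (pull_injective (Φ := S.tf.ratFnFunctor) (S.galoisSurj R.AN.base R.αData.isGalois (ιX y)).hom).eq_iff.symm.trans
    ?_
  simp only [map_mul, ModelFrobenioid.pull_hom_pull_inv]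

/-- **P55-L06c at the assembled §5 data: the structural binder `hcup` of abc-iut-w4-d008's
`Thm56Sub.cyclotomicRigidity_of_laws` / abc-iut-w5-d020's `cyclotomicRigidity_ofBiKummerData_of_laws` (VERBATIM) is
EQUIVALENT to the Galois-equivariance of the bi-Kummer cocycle of the root over `(l·Δ_Θ)`**, stated in the §4 setting's
vocabulary: for all `y₀ ∈ Π^tp_X̲` and all `y ∈ Π^tp_Ÿ̲` whose image `ρ(y)` lies over `(l·Δ_Θ)_{B_N}` (`∈ P.pre`), with
`g₀ = ρ_{A_N}(ιX y₀)`, `g = ρ_{A_N}(ιX y)` (`S.galoisSurj` at the Galois object `A_N^bs`) and `x ∈ B(A_N^bs)` the rational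
function of the `N`-th root `f_N` (`toB R.AN R.root`): `g^*(g₀^* x) · x = g^* x · g₀^* x` — the Kummer cocycle
`c(γ) = γ^* x / x` is multiplicative at `(g₀, g)`, equivalently `g` fixes `c(g₀)`, equivalently (left action
`γ ⋆ z = (γ⁻¹)^* z`, `κ(γ) = γ ⋆ x / x`) `κ(g₀ g g₀⁻¹) = g₀ ⋆ κ(g)`: "the part of `Π^tp_Ÿ̲` over `l·Δ_Θ` acts compatibly
on the Kummer classes of the root", which print draws from "the detailed description of the étale theta class in
Proposition 1.3" (Prop. 5.5 proof, p.327 (PDF p.101)).  The subquotient datum `P` and the stub `(l·Δ_Θ)_{(−)}` being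
FREE at `ofBiKummerData`, this is where the leaf now sits: one named condition on the setting's Galois action
`S.galoisSurj` and the root `R` (no new `Prop` constant).  Inputs `hσ`, `hfrac` as in abc-iut-L2-t4's
`biKummerDifferenceMem_ofBiKummerData`.  [cite: MochizukiEtTh2009, Prop 5.5 proof p.327–328 (PDF pp.101–102); §5 p.331 (PDF p.105)] -/
theorem hcup_iff_pull_root_mul (hσ : ∀ g : Aut R.AN.base, ModelFrobenioid.baseMap (σ g).hom = g.hom)
    (hfrac : ∀ {A B : S.C} (s' s'' : A ⟶ B) (h' : S.IsPreStep s') (h'' : S.IsPreStep s'')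
      (hb : PreFrobenioid.BaseEquivalent S.F s' s''),
      (toB A (S.fracOf s' s'' h' h'' hb) : S.tf.ratFnFunctor.obj (op A.base)) *
        ModelFrobenioid.unit s'' = ModelFrobenioid.unit s')
    (P : FrobenioidCyclotomicRigidity.ThetaSubquotientProj (ofBiKummerData h toB Q odd_l R ιX hopen σ K' constEmb constEmb_injective hdivc hdivp)) :
    (∀ (g : Aut ((ofBiKummerData h toB Q odd_l R ιX hopen σ K' constEmb constEmb_injective hdivc hdivp).base.obj (ofBiKummerData h toB Q odd_l R ιX hopen σ K' constEmb constEmb_injective hdivc hdivp).BN)) (k : (ofBiKummerData h toB Q odd_l R ιX hopen σ K' constEmb constEmb_injective hdivc hdivp).HB), (k : Aut ((ofBiKummerData h toB Q odd_l R ιX hopen σ K' constEmb constEmb_injective hdivc hdivp).base.obj (ofBiKummerData h toB Q odd_l R ιX hopen σ K' constEmb constEmb_injective hdivc hdivp).BN)) ∈ P.pre _ →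
        ∃ hmem : g * (k : Aut ((ofBiKummerData h toB Q odd_l R ιX hopen σ K' constEmb constEmb_injective hdivc hdivp).base.obj (ofBiKummerData h toB Q odd_l R ιX hopen σ K' constEmb constEmb_injective hdivc hdivp).BN)) * g⁻¹ ∈ (ofBiKummerData h toB Q odd_l R ιX hopen σ K' constEmb constEmb_injective hdivc hdivp).HB,
          (ofBiKummerData h toB Q odd_l R ιX hopen σ K' constEmb constEmb_injective hdivc hdivp).sgpCup ⟨g * (k : Aut ((ofBiKummerData h toB Q odd_l R ιX hopen σ K' constEmb constEmb_injective hdivc hdivp).base.obj (ofBiKummerData h toB Q odd_l R ιX hopen σ K' constEmb constEmb_injective hdivc hdivp).BN)) * g⁻¹, hmem⟩ = (ofBiKummerData h toB Q odd_l R ιX hopen σ K' constEmb constEmb_injective hdivc hdivp).sgpCap g * (ofBiKummerData h toB Q odd_l R ιX hopen σ K' constEmb constEmb_injective hdivc hdivp).sgpCup k * ((ofBiKummerData h toB Q odd_l R ιX hopen σ K' constEmb constEmb_injective hdivc hdivp).sgpCap g)⁻¹) ↔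
      ∀ (y₀ y : T.PiX), y ∈ T.PiYdd → rhoOfBiKummerData R ιX y ∈ P.pre R.BN.base →
        pull S.tf.ratFnFunctor (S.galoisSurj R.AN.base R.αData.isGalois (ιX y)).hom
            (pull S.tf.ratFnFunctor (S.galoisSurj R.AN.base R.αData.isGalois (ιX y₀)).hom
              (toB R.AN R.root : S.tf.ratFnFunctor.obj (op R.AN.base))) *
            (toB R.AN R.root : S.tf.ratFnFunctor.obj (op R.AN.base)) =
          pull S.tf.ratFnFunctor (S.galoisSurj R.AN.base R.αData.isGalois (ιX y)).hom
              (toB R.AN R.root : S.tf.ratFnFunctor.obj (op R.AN.base)) *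
            pull S.tf.ratFnFunctor (S.galoisSurj R.AN.base R.αData.isGalois (ιX y₀)).hom
              (toB R.AN R.root : S.tf.ratFnFunctor.obj (op R.AN.base)) := by
  constructor
  · intro H y₀ y hy hP
    obtain ⟨hmem, hEq⟩ := H (rhoOfBiKummerData R ιX y₀) ⟨rhoOfBiKummerData R ιX y, Subgroup.mem_map_of_mem _ hy⟩ hP
    exact (sgpCup_conj_eq_iff_pull_root h toB Q odd_l R ιX hopen σ K' constEmb constEmb_injective hdivc hdivp hσ hfrac y₀ y hy ⟨_, hmem⟩ rfl).mp hEq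
  · rintro H g ⟨k, hkHB⟩ hkP
    obtain ⟨y₀, rfl⟩ := rhoOfBiKummerData_surjective R ιX g
    obtain ⟨y, hy, rfl⟩ := Subgroup.mem_map.mp hkHB
    exact ⟨(ofBiKummerData h toB Q odd_l R ιX hopen σ K' constEmb constEmb_injective hdivc hdivp).conj_mem_HB _ ⟨_, hkHB⟩,
      (sgpCup_conj_eq_iff_pull_root h toB Q odd_l R ιX hopen σ K' constEmb constEmb_injective hdivc hdivp hσ hfrac y₀ y hy ⟨_, (ofBiKummerData h toB Q odd_l R ιX hopen σ K' constEmb constEmb_injective hdivc hdivp).conj_mem_HB _ ⟨_, hkHB⟩⟩ rfl).mpr (H y₀ y hy hkP)⟩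

end Kummer

end ThetaFrobenioid

end Literature.AnabelianGeometry.EtaleTheta

end
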